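import Literature.AnabelianGeometry.AbsoluteAnabelian.MLFGaloisPairs
import Mathlib.CategoryTheory.Category.Basic
import Mathlib.CategoryTheory.ObjectProperty.FullSubcategory

/-!
# The categories `𝒞^MLF_T` of MLF-Galois pairs ([AbsTopIII] Definition 3.1 (iii))

S. Mochizuki, *Topics in absolute anabelian geometry III*, Def 3.1 (iii) p.67: "Write `𝒞^MLF_T` for the
category whose objects are the MLF-Galois `T`-pairs and whose morphisms are the morphisms of MLF-Galois
`T`-pairs" (bib key `MochizukiAbsTopIII2015`; locators = kurims manuscript pages).  This file gives the
honest Mathlib `Category` instances on the pair types of `MLFGaloisPairs.lean` (morphisms = `Hom` of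
Def 3.1 (ii): `φ_M` + compatible continuous `φ_Π` inducing an open injection on arithmetic Galois
groups — the composite of two such is again one, PROVED), the full subcategories `𝒞^MLF_T ⊆` (all
pairs) cut out by `IsMLFGaloisMonoidPair T` / `IsMLFGaloisFieldPair`, and the forgetful functor
`(Π ↷ M) ↦ Π` to topological groups at the level of objects/maps.

Deliberately NOT here: the natural functors `𝒞_TF → 𝒞_TM → 𝒞_TLG → 𝒞_TCG` on ABSTRACT pairs (they
need the topology / Galois-invariant structure of Rmk 3.1.1 to single out "integral elements"; on
MODEL data they are `ModelMLFGaloisData.monoidPair`), the subcategories of `T`-isomorphisms and Galois-isomorphisms,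
`TG ⊇ TG^hyp ⊇ TG^sB` (scheme-theoretic; seat abc-iut-L4-t1).
-/

namespace Literature.AnabelianGeometry.AbsoluteAnabelian

open _root_.CategoryTheory

universe u

namespace GaloisMonoidPair

variable {P Q R : GaloisMonoidPair.{u}}

/-- Two morphisms of pairs with the same components are equal. [cite: MochizukiAbsTopIII2015, Definition 3.1 (ii) p.67] -/
@[ext]
theorem Hom.ext {φ ψ : P.Hom Q} (hPi : φ.homPi = ψ.homPi) (hM : φ.homM = ψ.homM) : φ = ψ := by
  cases φ; cases ψ; congr

/-- The identity morphism of a pair. [cite: MochizukiAbsTopIII2015, Definition 3.1 (iii) p.67] -/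
def Hom.id (P : GaloisMonoidPair.{u}) : P.Hom P where
  homPi := MonoidHom.id _
  continuous_homPi := continuous_id
  homM := MonoidHom.id _
  smul_comm _ _ := rfl
  comap_ker := Subgroup.comap_id _
  isOpen_image U hU := by
    have : U.map (MonoidHom.id P.Pi) ⊔ P.actionKer = U ⊔ P.actionKer := by rw [Subgroup.map_id]
    rw [this]
    exact Subgroup.isOpen_mono le_sup_left hU

/-- Composition of morphisms of pairs ("a compatible continuous homomorphism … that induces an open
injective homomorphism between the respective arithmetic Galois groups" is stable under composition).
[cite: MochizukiAbsTopIII2015, Definition 3.1 (iii) p.67] -/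
def Hom.comp (φ : P.Hom Q) (ψ : Q.Hom R) : P.Hom R where
  homPi := ψ.homPi.comp φ.homPi
  continuous_homPi := ψ.continuous_homPi.comp φ.continuous_homPi
  homM := ψ.homM.comp φ.homM
  smul_comm g x := by simp [φ.smul_comm, ψ.smul_comm]
  comap_ker := by rw [← Subgroup.comap_comap, ψ.comap_ker, φ.comap_ker]
  isOpen_image U hU := by
    have h₁ := φ.isOpen_image U hU
    have h₂ := ψ.isOpen_image _ h₁
    have hker : Q.actionKer.map ψ.homPi ≤ R.actionKer := by
      rw [Subgroup.map_le_iff_le_comap, ψ.comap_ker]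
    have : (U.map φ.homPi ⊔ Q.actionKer).map ψ.homPi ⊔ R.actionKer =
        U.map (ψ.homPi.comp φ.homPi) ⊔ R.actionKer := by
      rw [Subgroup.map_sup, Subgroup.map_map, sup_assoc, sup_eq_right.mpr hker]
    rw [← this]
    exact h₂

/-- **Def 3.1 (iii): the category of pairs `(Π ↷ M)`** (all pairs of type `TCG/TLG/TM`-shape; the
categories `𝒞^MLF_T` are its full subcategories below).
[cite: MochizukiAbsTopIII2015, Definition 3.1 (iii) p.67] -/
instance category : Category GaloisMonoidPair.{u} where
  Hom P Q := P.Hom Q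
  id P := Hom.id P
  comp φ ψ := Hom.comp φ ψ
  id_comp φ := by ext <;> rfl
  comp_id φ := by ext <;> rfl
  assoc φ ψ χ := by ext <;> rfl

end GaloisMonoidPair

/-- **Def 3.1 (iii): `𝒞^MLF_T`** for `T ∈ {TCG, TLG, TM}` — the full subcategory of MLF-Galois `T`-pairs.
[cite: MochizukiAbsTopIII2015, Definition 3.1 (iii) p.67] -/
def MLFGaloisMonoidPairCat (T : PairType) : Type (u + 1) :=
  ObjectProperty.FullSubcategory (fun P : GaloisMonoidPair.{u} => IsMLFGaloisMonoidPair T P)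

/-- The category structure on `𝒞^MLF_T` (full subcategory). [cite: MochizukiAbsTopIII2015, Definition 3.1 (iii) p.67] -/
instance (T : PairType) : Category (MLFGaloisMonoidPairCat.{u} T) :=
  inferInstanceAs (Category (ObjectProperty.FullSubcategory _))

namespace GaloisFieldPair

variable {P Q R : GaloisFieldPair.{u}}

/-- Two morphisms of `TF`-pairs with the same components are equal. [cite: MochizukiAbsTopIII2015, Definition 3.1 (ii) p.67] -/
@[ext]
theorem Hom.ext {φ ψ : P.Hom Q} (hPi : φ.homPi = ψ.homPi) (hM : φ.homM = ψ.homM) : φ = ψ := by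
  cases φ; cases ψ; congr

/-- The identity morphism. [cite: MochizukiAbsTopIII2015, Definition 3.1 (iii) p.67] -/
def Hom.id (P : GaloisFieldPair.{u}) : P.Hom P where
  homPi := MonoidHom.id _
  continuous_homPi := continuous_id
  homM := RingHom.id _
  smul_comm _ _ := rfl
  comap_ker := Subgroup.comap_id _
  isOpen_image U hU := by
    have : U.map (MonoidHom.id P.Pi) ⊔ P.actionKer = U ⊔ P.actionKer := by rw [Subgroup.map_id]
    rw [this]
    exact Subgroup.isOpen_mono le_sup_left hU

/-- Composition of morphisms of `TF`-pairs. [cite: MochizukiAbsTopIII2015, Definition 3.1 (iii) p.67] -/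
def Hom.comp (φ : P.Hom Q) (ψ : Q.Hom R) : P.Hom R where
  homPi := ψ.homPi.comp φ.homPi
  continuous_homPi := ψ.continuous_homPi.comp φ.continuous_homPi
  homM := ψ.homM.comp φ.homM
  smul_comm g x := by simp [φ.smul_comm, ψ.smul_comm]
  comap_ker := by rw [← Subgroup.comap_comap, ψ.comap_ker, φ.comap_ker]
  isOpen_image U hU := by
    have h₁ := φ.isOpen_image U hU
    have h₂ := ψ.isOpen_image _ h₁
    have hker : Q.actionKer.map ψ.homPi ≤ R.actionKer := by
      rw [Subgroup.map_le_iff_le_comap, ψ.comap_ker]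
    have : (U.map φ.homPi ⊔ Q.actionKer).map ψ.homPi ⊔ R.actionKer =
        U.map (ψ.homPi.comp φ.homPi) ⊔ R.actionKer := by
      rw [Subgroup.map_sup, Subgroup.map_map, sup_assoc, sup_eq_right.mpr hker]
    rw [← this]
    exact h₂

/-- **Def 3.1 (iii): the category of `TF`-shaped pairs.** [cite: MochizukiAbsTopIII2015, Definition 3.1 (iii) p.67] -/
instance category : Category GaloisFieldPair.{u} where
  Hom P Q := P.Hom Q
  id P := Hom.id P
  comp φ ψ := Hom.comp φ ψ
  id_comp φ := by ext <;> rfl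
  comp_id φ := by ext <;> rfl
  assoc φ ψ χ := by ext <;> rfl

end GaloisFieldPair

/-- **Def 3.1 (iii): `𝒞^MLF_TF`** — the full subcategory of MLF-Galois `TF`-pairs.
[cite: MochizukiAbsTopIII2015, Definition 3.1 (iii) p.67] -/
def MLFGaloisFieldPairCat : Type (u + 1) :=
  ObjectProperty.FullSubcategory (fun P : GaloisFieldPair.{u} => IsMLFGaloisFieldPair P)

/-- The category structure on `𝒞^MLF_TF`. [cite: MochizukiAbsTopIII2015, Definition 3.1 (iii) p.67] -/
instance : Category MLFGaloisFieldPairCat.{u} :=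
  inferInstanceAs (Category (ObjectProperty.FullSubcategory _))

end Literature.AnabelianGeometry.AbsoluteAnabelian
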